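import Summits.KontsevichZagierPeriods.KontsevichZagierPeriods.Theorems.LinRedNormalFormWheelThreeSpokesCharts

/-!
# `WheelThreeSpokes` (stmt-KontsevichZagierPeriods-3913), line `laplacian-ldl-chart`: the two
integrand splits and the Newton–Leibniz descent `5 → 4`

Three stubs of the lead's skeleton (`Cruxes/WheelThreeSpokes/Lines/laplacian-ldl-chart.lean`):

* `stub_fSplit` — rule (1b) on the simplex `1 > t₀ > t₁ > t₂ > 0`:
  `1/(t₀t₁(1−t₁)(1−t₂)) = 1/(t₀t₁(1−t₂)) + 1/(t₀(1−t₁)(1−t₂))` (`F_dih = ζ(3)`-word `+ ζ(2,1)`-word);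
* `stub_eSplit` — rule (1b) with a sign: `E_dih = E₁ − E₂`,
  `(t₁−t₂)/(t₀(t₀−t₂)(1−t₂)(1−t₁)t₁) = 1/(t₀(t₀−t₂)(1−t₁)) − t₂/(t₀(t₀−t₂)(1−t₂)t₁)`
  (the negative representation `E₂.neg` enters the additivity instance; `[E₂] + [E₂.neg]` is a
  relation, `KZ.of_add_of_neg_mem_levelRel`);
* `stub_nlFiveFour` — rule (3) between dimensions `5` and `4`: the representation
  `[D5T, 1/(d₂C)]`, whose integrand does not depend on the last coordinate `t ∈ (0,1)`, is the
  reverse Newton–Leibniz unfolding (`JanusBands.IntegrateOutLow.exists_unfold_step`, primitive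
  `t·g`) of the base `F4 = [D4, 1/(d₂C)]`, up to congruence of open bands.

In each case the new representation EXISTS because its integrand is a sum/difference of the given
absolutely integrable ones (no convergence estimate), and is `ℚ`-semialgebraic as a quotient of
polynomials with non-vanishing denominator.

References: M. Kontsevich, D. Zagier, *Periods* (2001), §1.2 rules (1), (3).
-/

noncomputable section

open Set MeasureTheory MvPolynomial
open Literature.NumberTheory.Transcendental
open Literature.ModelTheory.ExponentialFields (IsSemialgebraic)

namespace Summit.KontsevichZagierPeriods.LinRedNormalForm.WheelThreeSpokes

/-- **stub_fSplit**: `F_dih = ζ(3)`-word `+ ζ(2,1)`-word on the simplex is one instance of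
integrand additivity (rule 1b); the `F_dih` representation exists as the sum of the two given
ones. [cite: KontsevichZagier2001, §1.2 rule (1)] -/
theorem stub_fSplit :
    ∀ z z' : KZ.IntegralRep 3, z.domain = {t : Fin 3 → ℝ | 1 > t 0 ∧ t 0 > t 1 ∧ t 1 > t 2 ∧ t 2 > 0} →
      Set.EqOn z.integrand (fun t => 1 / (t 0 * t 1 * (1 - t 2))) z.domain →
      z'.domain = {t : Fin 3 → ℝ | 1 > t 0 ∧ t 0 > t 1 ∧ t 1 > t 2 ∧ t 2 > 0} →
      Set.EqOn z'.integrand (fun t => 1 / (t 0 * (1 - t 1) * (1 - t 2))) z'.domain →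
      ∃ d : KZ.IntegralRep 3, d.domain = {t : Fin 3 → ℝ | 1 > t 0 ∧ t 0 > t 1 ∧ t 1 > t 2 ∧ t 2 > 0} ∧
        (d.integrand = fun t => 1 / (t 0 * t 1 * (1 - t 1) * (1 - t 2))) ∧
        KZ.of d - KZ.of z - KZ.of z' ∈ KZ.relations := by
  intro z z' hzd hzi hz'd hz'i
  have hS : IsSemialgebraic ℚ {t : Fin 3 → ℝ | 1 > t 0 ∧ t 0 > t 1 ∧ t 1 > t 2 ∧ t 2 > 0} :=
    isSemialgebraic_typedSimplex
  have hSm : MeasurableSet {t : Fin 3 → ℝ | 1 > t 0 ∧ t 0 > t 1 ∧ t 1 > t 2 ∧ t 2 > 0} :=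
    IsSemialgebraic.measurableSet_holds hS
  have hsa : IsSemialgebraicFunOn ℚ {t : Fin 3 → ℝ | 1 > t 0 ∧ t 0 > t 1 ∧ t 1 > t 2 ∧ t 2 > 0}
      (fun t : Fin 3 → ℝ => 1 / (t 0 * t 1 * (1 - t 1) * (1 - t 2))) := by
    refine (isSemialgebraicFunOn_aeval_div_aeval hS (1 : MvPolynomial (Fin 3) ℚ)
      (X 0 * X 1 * (1 - X 1) * (1 - X 2)) ?_).congr ?_
    · rintro t ⟨h0, h01, h12, h2⟩
      have : 0 < t 1 := by linarith
      have : 0 < t 0 := by linarith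
      have : 0 < 1 - t 1 := by linarith
      have : 0 < 1 - t 2 := by linarith
      simp only [map_mul, map_sub, map_one, aeval_X]
      positivity
    · intro t _
      simp
  have hsum : ∀ t ∈ {t : Fin 3 → ℝ | 1 > t 0 ∧ t 0 > t 1 ∧ t 1 > t 2 ∧ t 2 > 0},
      1 / (t 0 * t 1 * (1 - t 1) * (1 - t 2)) =
        1 / (t 0 * t 1 * (1 - t 2)) + 1 / (t 0 * (1 - t 1) * (1 - t 2)) := by
    rintro t ⟨h0, h01, h12, h2⟩
    have ht0 : t 0 ≠ 0 := by apply ne_of_gt; linarith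
    have ht1 : t 1 ≠ 0 := by apply ne_of_gt; linarith
    have ht1' : 1 - t 1 ≠ 0 := by apply ne_of_gt; linarith
    have ht2' : 1 - t 2 ≠ 0 := by apply ne_of_gt; linarith
    field_simp
    ring
  have hz1 : IntegrableOn (fun t : Fin 3 → ℝ => 1 / (t 0 * t 1 * (1 - t 2)))
      {t : Fin 3 → ℝ | 1 > t 0 ∧ t 0 > t 1 ∧ t 1 > t 2 ∧ t 2 > 0} := by
    have h := z.integrableOn.congr_fun hzi (KZ.IntegralRep.measurableSet_domain_holds z)
    rwa [hzd] at h
  have hz2 : IntegrableOn (fun t : Fin 3 → ℝ => 1 / (t 0 * (1 - t 1) * (1 - t 2)))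
      {t : Fin 3 → ℝ | 1 > t 0 ∧ t 0 > t 1 ∧ t 1 > t 2 ∧ t 2 > 0} := by
    have h := z'.integrableOn.congr_fun hz'i (KZ.IntegralRep.measurableSet_domain_holds z')
    rwa [hz'd] at h
  have hint : IntegrableOn (fun t : Fin 3 → ℝ => 1 / (t 0 * t 1 * (1 - t 1) * (1 - t 2)))
      {t : Fin 3 → ℝ | 1 > t 0 ∧ t 0 > t 1 ∧ t 1 > t 2 ∧ t 2 > 0} :=
    (hz1.add hz2).congr_fun (fun t ht => (hsum t ht).symm) hSm
  let d : KZ.IntegralRep 3 := ⟨_, _, hS, hsa, hint⟩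
  refine ⟨d, rfl, rfl, ?_⟩
  refine KZ.integrandAddRel_subset_relations ⟨3, d, z, z', hzd, hz'd, fun t ht => ?_, rfl⟩
  have htz : t ∈ z.domain := by rw [hzd]; exact ht
  have htz' : t ∈ z'.domain := by rw [hz'd]; exact ht
  rw [Pi.add_apply, hzi htz, hz'i htz']
  exact hsum t ht

/-- **stub_eSplit**: `E_dih = E₁ − E₂` on the simplex is one instance of integrand additivity
(rule 1b, with the negative representation `E₂.neg`) plus the junk relation `[E₂] + [E₂.neg]`;
the `E_dih` representation exists as the difference of the two given ones.
[cite: KontsevichZagier2001, §1.2 rule (1)] -/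
theorem stub_eSplit :
    ∀ e₁ e₂ : KZ.IntegralRep 3, e₁.domain = {t : Fin 3 → ℝ | 1 > t 0 ∧ t 0 > t 1 ∧ t 1 > t 2 ∧ t 2 > 0} →
      Set.EqOn e₁.integrand (fun t => 1 / (t 0 * (t 0 - t 2) * (1 - t 1))) e₁.domain →
      e₂.domain = {t : Fin 3 → ℝ | 1 > t 0 ∧ t 0 > t 1 ∧ t 1 > t 2 ∧ t 2 > 0} →
      Set.EqOn e₂.integrand (fun t => t 2 / (t 0 * (t 0 - t 2) * (1 - t 2) * t 1)) e₂.domain →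
      ∃ d : KZ.IntegralRep 3, d.domain = {t : Fin 3 → ℝ | 1 > t 0 ∧ t 0 > t 1 ∧ t 1 > t 2 ∧ t 2 > 0} ∧
        (d.integrand = fun t => (t 1 - t 2) / (t 0 * (t 0 - t 2) * (1 - t 2) * (1 - t 1) * t 1)) ∧
        KZ.of d - KZ.of e₁ + KZ.of e₂ ∈ KZ.relations := by
  intro e₁ e₂ he₁d he₁i he₂d he₂i
  have hS : IsSemialgebraic ℚ {t : Fin 3 → ℝ | 1 > t 0 ∧ t 0 > t 1 ∧ t 1 > t 2 ∧ t 2 > 0} :=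
    isSemialgebraic_typedSimplex
  have hSm : MeasurableSet {t : Fin 3 → ℝ | 1 > t 0 ∧ t 0 > t 1 ∧ t 1 > t 2 ∧ t 2 > 0} :=
    IsSemialgebraic.measurableSet_holds hS
  have hsa : IsSemialgebraicFunOn ℚ {t : Fin 3 → ℝ | 1 > t 0 ∧ t 0 > t 1 ∧ t 1 > t 2 ∧ t 2 > 0}
      (fun t : Fin 3 → ℝ => (t 1 - t 2) / (t 0 * (t 0 - t 2) * (1 - t 2) * (1 - t 1) * t 1)) := by
    refine (isSemialgebraicFunOn_aeval_div_aeval hS (X 1 - X 2 : MvPolynomial (Fin 3) ℚ)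
      (X 0 * (X 0 - X 2) * (1 - X 2) * (1 - X 1) * X 1) ?_).congr ?_
    · rintro t ⟨h0, h01, h12, h2⟩
      have : 0 < t 1 := by linarith
      have : 0 < t 0 := by linarith
      have : 0 < t 0 - t 2 := by linarith
      have : 0 < 1 - t 1 := by linarith
      have : 0 < 1 - t 2 := by linarith
      simp only [map_mul, map_sub, map_one, aeval_X]
      positivity
    · intro t _
      simp
  have hsum : ∀ t ∈ {t : Fin 3 → ℝ | 1 > t 0 ∧ t 0 > t 1 ∧ t 1 > t 2 ∧ t 2 > 0},
      (t 1 - t 2) / (t 0 * (t 0 - t 2) * (1 - t 2) * (1 - t 1) * t 1) =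
        1 / (t 0 * (t 0 - t 2) * (1 - t 1)) + -(t 2 / (t 0 * (t 0 - t 2) * (1 - t 2) * t 1)) := by
    rintro t ⟨h0, h01, h12, h2⟩
    have ht0 : t 0 ≠ 0 := by apply ne_of_gt; linarith
    have ht1 : t 1 ≠ 0 := by apply ne_of_gt; linarith
    have ht02 : t 0 - t 2 ≠ 0 := by apply ne_of_gt; linarith
    have ht1' : 1 - t 1 ≠ 0 := by apply ne_of_gt; linarith
    have ht2' : 1 - t 2 ≠ 0 := by apply ne_of_gt; linarith
    field_simp
    ring
  have he1 : IntegrableOn (fun t : Fin 3 → ℝ => 1 / (t 0 * (t 0 - t 2) * (1 - t 1)))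
      {t : Fin 3 → ℝ | 1 > t 0 ∧ t 0 > t 1 ∧ t 1 > t 2 ∧ t 2 > 0} := by
    have h := e₁.integrableOn.congr_fun he₁i (KZ.IntegralRep.measurableSet_domain_holds e₁)
    rwa [he₁d] at h
  have he2 : IntegrableOn (fun t : Fin 3 → ℝ => t 2 / (t 0 * (t 0 - t 2) * (1 - t 2) * t 1))
      {t : Fin 3 → ℝ | 1 > t 0 ∧ t 0 > t 1 ∧ t 1 > t 2 ∧ t 2 > 0} := by
    have h := e₂.integrableOn.congr_fun he₂i (KZ.IntegralRep.measurableSet_domain_holds e₂)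
    rwa [he₂d] at h
  have hint : IntegrableOn
      (fun t : Fin 3 → ℝ => (t 1 - t 2) / (t 0 * (t 0 - t 2) * (1 - t 2) * (1 - t 1) * t 1))
      {t : Fin 3 → ℝ | 1 > t 0 ∧ t 0 > t 1 ∧ t 1 > t 2 ∧ t 2 > 0} :=
    (he1.add he2.neg).congr_fun (fun t ht => (hsum t ht).symm) hSm
  let d : KZ.IntegralRep 3 := ⟨_, _, hS, hsa, hint⟩
  refine ⟨d, rfl, rfl, ?_⟩
  have hadd : KZ.of d - KZ.of e₁ - KZ.of e₂.neg ∈ KZ.relations := by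
    refine KZ.integrandAddRel_subset_relations ⟨3, d, e₁, e₂.neg, he₁d, ?_, fun t ht => ?_, rfl⟩
    · rw [KZ.IntegralRep.domain_neg, he₂d]
    · have ht1 : t ∈ e₁.domain := by rw [he₁d]; exact ht
      have ht2 : t ∈ e₂.domain := by rw [he₂d]; exact ht
      rw [Pi.add_apply, KZ.IntegralRep.integrand_neg, Pi.neg_apply, he₁i ht1, he₂i ht2]
      exact hsum t ht
  have hneg : KZ.of e₂ + KZ.of e₂.neg ∈ KZ.relations :=
    KZ.levelRel_le_relations (KZ.of_add_of_neg_mem_levelRel e₂)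
  have : KZ.of d - KZ.of e₁ + KZ.of e₂ =
      (KZ.of d - KZ.of e₁ - KZ.of e₂.neg) + (KZ.of e₂ + KZ.of e₂.neg) := by abel
  rw [this]
  exact KZ.relations.add_mem hadd hneg

/-- **stub_nlFiveFour**: Newton–Leibniz between dimensions `5` and `4` (rule 3 along the last
coordinate `t ∈ [0,1]`, rational primitive `t/(d₂C)`): the `t`-free representation
`[D5T, 1/(d₂C)]` is congruent to the reverse unfolding of the base `[D4, 1/(d₂C)]`
(`JanusBands.IntegrateOutLow.exists_unfold_step` with `A = 0`, `B = 1`), hence differs from it by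
relations. [cite: KontsevichZagier2001, §1.2 rule (3)] -/
theorem stub_nlFiveFour :
    ∀ (b : KZ.IntegralRep 5) (r₄ : KZ.IntegralRep 4),
      b.domain = {y : Fin 5 → ℝ | 0 < y 0 ∧ 0 < y 1 ∧ y 0 + y 1 < 1 ∧ y 0 * y 1 < y 2 * y 3 ∧ y 0 * (1 - y 0 - y 1) < y 3 * (1 - y 2) ∧ 0 < y 4 ∧ y 4 < 1} →
      Set.EqOn b.integrand (fun y => 1 / (y 3 * (y 1 * (1 - y 0 - y 1) + y 2 * (1 - y 2) * y 3))) b.domain →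
      r₄.domain = {p : Fin 4 → ℝ | 0 < p 0 ∧ 0 < p 1 ∧ p 0 + p 1 < 1 ∧ p 0 * p 1 < p 2 * p 3 ∧ p 0 * (1 - p 0 - p 1) < p 3 * (1 - p 2)} →
      Set.EqOn r₄.integrand (fun p => 1 / (p 3 * (p 1 * (1 - p 0 - p 1) + p 2 * (1 - p 2) * p 3))) r₄.domain →
      KZ.of b - KZ.of r₄ ∈ KZ.relations := by
  intro b r₄ hbd hbi hr₄d hr₄i
  have hg : IsSemialgebraicFunOn ℚ r₄.domain
      (fun p : Fin 4 → ℝ => 1 / (p 3 * (p 1 * (1 - p 0 - p 1) + p 2 * (1 - p 2) * p 3))) :=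
    r₄.isSemialgebraicFunOn_integrand.congr hr₄i
  obtain ⟨U, hUd, hUi, hUrel⟩ := ArrangementNormalForm.JanusBands.IntegrateOutLow.exists_unfold_step
    r₄ (0 : MvPolynomial (Fin 4) ℚ) 1
    (fun p : Fin 4 → ℝ => 1 / (p 3 * (p 1 * (1 - p 0 - p 1) + p 2 * (1 - p 2) * p 3))) hg
    (fun x _ => by simp) (fun x hx => by rw [hr₄i hx]; simp)
  -- components of `Fin.init` and the last coordinate, definitionally
  have e0 : ∀ z : Fin 5 → ℝ, Fin.init z 0 = z 0 := fun _ => rfl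
  have e1 : ∀ z : Fin 5 → ℝ, Fin.init z 1 = z 1 := fun _ => rfl
  have e2 : ∀ z : Fin 5 → ℝ, Fin.init z 2 = z 2 := fun _ => rfl
  have e3 : ∀ z : Fin 5 → ℝ, Fin.init z 3 = z 3 := fun _ => rfl
  have e4 : ∀ z : Fin 5 → ℝ, z (Fin.last 4) = z 4 := fun _ => rfl
  have hdom : U.domain = b.domain := by
    rw [hUd, hbd, hr₄d]
    ext z
    simp only [mem_setOf_eq, map_zero, map_one, e0, e1, e2, e3, e4]
    tauto
  have hint : EqOn b.integrand U.integrand b.domain := by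
    intro z hz
    rw [hbi hz, hUi]
    simp only [e0, e1, e2, e3]
  have h1 : KZ.of b - KZ.of U ∈ KZ.relations := KZ.of_sub_of_mem_relations_of_eqOn hdom hint
  have : KZ.of b - KZ.of r₄ = (KZ.of b - KZ.of U) - (KZ.of r₄ - KZ.of U) := by abel
  rw [this]
  exact KZ.relations.sub_mem h1 hUrel

end Summit.KontsevichZagierPeriods.LinRedNormalForm.WheelThreeSpokes
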